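import Summits.CriticalPhenomena.PercolationContinuityZ3.Theorems.SahiMasterFamilyPointwise
import Summits.CriticalPhenomena.PercolationContinuityZ3.Theorems.SahiMasterFamilyPrincipalCapBeta
import Summits.CriticalPhenomena.PercolationContinuityZ3.Theorems.SahiMasterFamilyStrictHarris
import Summits.CriticalPhenomena.PercolationContinuityZ3.Theorems.PercNearOneGluingNoHeavyLowerTailSahiCombPrincipalMeet
import Summits.CriticalPhenomena.PercolationContinuityZ3.Theorems.PercNearOneGluingNoHeavyLowerTailSahiCombDisjunctThreeIdentities
import Summits.CriticalPhenomena.PercolationContinuityZ3.Theorems.SahiMasterFamilyResidualStep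
import Summits.CriticalPhenomena.PercolationContinuityZ3.Theorems.SahiMasterFamilySharedCoordinate

/-!
# Rigidity transfer: pointwise (EQ-k) on the principal-cap stratum from ANY product-of-atoms certificate for `F(k)`

Unit `prim-master-conj` (crux anchor stmt-CriticalPhenomena-4575, helper work), gen 13.  Seat P4's β-normal form
(`PrincipalCapBeta.sahiE_ind_eq_mul_phiSet`: `E_k(μ_p; 1_U) = (∏_j P_j)·Φ_k(β(p))` on the principal-cap stratum) reduces Sahi's `C_k` there to
`F(k) : Φ_k(β) ≥ 0`, and P4's certificates (orders `≤ 6`, `…PrincipalCapBetaSmall/SixMain`) write `Φ_k` — under `β_⊤ = 1` — as a positive combination of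
PRODUCTS of the atoms `β_S`, `1 − β_S`, `β_S − β_Aβ_B` (`A ∪ B = S`).  This file supplies what turns such a certificate into the POINTWISE statement
"`E_k(μ_p; 1_U) = 0` at one interior `p` iff `U ∈ Z_k`" WITHOUT a comb lift:

* **the atoms are rigid** (`beta_transfer_base/defect/gap`): for interior `p, q`, each atom is `≥ 0` at `β(p)` and at `β(q)`, and if it vanishes at
  `β(p)` it vanishes at `β(q)` — for `β_S` because `μ_p(⋂_S U) = 0` forces `⋂_S U = ∅`; for `1 − β_S` because it forces `⋂_S U = [K_S]`; for the
  Harris gap because `β_S − β_Aβ_B = (P_{A∩B}/P_S)·Cov_p(X', Y')` with `X', Y'` the set-sections of `⋂_A U, ⋂_B U` above the cylinder `[K_{A∩B}]`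
  (`beta_gap_eq`), and `Cov_p(X',Y') = 0` at an interior `p` is the equality case of Harris (`disjoint_determinedBy_of_real_inter_eq`), which
  persists at every `q`;
* **the transfer calculus** (`tr_add`, `tr_mul`, `tr_const`, `tr_of_eq`): the relation `0 ≤ x ∧ 0 ≤ y ∧ (x = 0 → y = 0)` is closed under sums and
  products, so it passes from the atoms to any positive combination of products of atoms (a syntactic `repeat`/`first` walk over the certificate);
* **the reduction** (`sahiE_ind_eq_zero_iff_of_principalCap_of_phiTransfer`): if `Φ_{k+1}(β) = 0 ⟹ Φ_{k+1}(β') = 0` whenever the atoms transfer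
  from `β` to `β'` (hypothesis `PT`, discharged at order six in `…PointwisePrincipalCapSix` from P4's 872-product certificate), then for every
  principal-cap `(k+1)`-family `U` and interior `p`: `E_{k+1}(μ_p; 1_U) = 0 ↔ U ∈ Z_{k+1}` (zero at `p` ⟹ zero on the open cube ⟹ `Z` by (EQI),
  `Pointwise.suppZeroFlag_of_eq_zero_on_paramBox`).
Axioms standard. [this work]
-/

noncomputable section

open scoped Classical

namespace Summit.CriticalPhenomena.PercolationContinuityZ3.Theorems

open Finset Function
open Literature.Combinatorics.Sahi2008
open Literature.Probability.LatticeModels (prodBernoulli prodBernoulli_real_inter_of_determinedBy_disjoint)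
open Literature.Probability.Percolation (DeterminedBy)
open Literature.Probability.Percolation.DecisionTree (ind ind_of_mem ind_of_not_mem ind_nonneg)
open SahiComb PrincipalCapBeta

namespace Pointwise

/-! ### 1. The transfer calculus -/

/-- Sums: `(x, y), (x', y')` transfer ⟹ `(x + x', y + y')` transfers. [this work] -/
theorem tr_add {x y x' y' : ℝ} (h : 0 ≤ x ∧ 0 ≤ y ∧ (x = 0 → y = 0)) (h' : 0 ≤ x' ∧ 0 ≤ y' ∧ (x' = 0 → y' = 0)) :
    0 ≤ x + x' ∧ 0 ≤ y + y' ∧ (x + x' = 0 → y + y' = 0) := by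
  obtain ⟨hx, hy, hxy⟩ := h
  obtain ⟨hx', hy', hxy'⟩ := h'
  refine ⟨add_nonneg hx hx', add_nonneg hy hy', fun hs => ?_⟩
  have h1 : x = 0 := le_antisymm (by linarith) hx
  have h2 : x' = 0 := le_antisymm (by linarith) hx'
  rw [hxy h1, hxy' h2, add_zero]

/-- Products: `(x, y), (x', y')` transfer ⟹ `(x·x', y·y')` transfers. [this work] -/
theorem tr_mul {x y x' y' : ℝ} (h : 0 ≤ x ∧ 0 ≤ y ∧ (x = 0 → y = 0)) (h' : 0 ≤ x' ∧ 0 ≤ y' ∧ (x' = 0 → y' = 0)) :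
    0 ≤ x * x' ∧ 0 ≤ y * y' ∧ (x * x' = 0 → y * y' = 0) := by
  obtain ⟨hx, hy, hxy⟩ := h
  obtain ⟨hx', hy', hxy'⟩ := h'
  refine ⟨mul_nonneg hx hx', mul_nonneg hy hy', fun hs => ?_⟩
  rcases mul_eq_zero.1 hs with h0 | h0
  · rw [hxy h0, zero_mul]
  · rw [hxy' h0, mul_zero]

/-- Nonnegative constants transfer to themselves. [this work] -/
theorem tr_const {c : ℝ} (hc : 0 ≤ c) : 0 ≤ c ∧ 0 ≤ c ∧ (c = 0 → c = 0) := ⟨hc, hc, id⟩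

/-- Transport of a transfer along two equations (used with the expansions `pieceN_eq` of a certificate). [this work] -/
theorem tr_of_eq {L R L' R' : ℝ} (e : L = R) (e' : L' = R') (H : 0 ≤ L ∧ 0 ≤ L' ∧ (L = 0 → L' = 0)) :
    0 ≤ R ∧ 0 ≤ R' ∧ (R = 0 → R' = 0) := by
  subst e e'; exact H

/-- `a = b`, `c = d` ⟹ `a + c = b + d` (keeps the syntactic shape `_ + _`). [folklore] -/
theorem add_eq_add {a b c d : ℝ} (h1 : a = b) (h2 : c = d) : a + c = b + d := by rw [h1, h2]

/-! ### 2. The atoms of the β-normal form are rigid -/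

section Atoms

variable {ι : Type} [Fintype ι] {k : ℕ}

omit [Fintype ι] in
/-- Core products are positive in the open cube. [this work] -/
theorem prod_coreP_pos {p : ι → unitInterval} (hp : ∀ e, (p e : ℝ) ∈ Set.Ioo (0 : ℝ) 1) (K : Fin k → Finset ι)
    (B : Finset (Fin k)) : 0 < ∏ j ∈ B, coreP p K j :=
  prod_pos fun j _ => by unfold coreP; exact prod_pos fun e _ => (hp e).1

/-- **The atom `β_B` is rigid**: for interior `p, q`, `β_B(p) = 0 ⟹ β_B(q) = 0` (and both are `≥ 0`). [this work] -/
theorem beta_transfer_base {p : ι → unitInterval} (q : ι → unitInterval) (hp : ∀ e, (p e : ℝ) ∈ Set.Ioo (0 : ℝ) 1)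
    (U : Fin k → Set (Set ι)) (K : Fin k → Finset ι) (B : Finset (Fin k)) :
    0 ≤ beta p U K B ∧ 0 ≤ beta q U K B ∧ (beta p U K B = 0 → beta q U K B = 0) := by
  refine ⟨beta_nonneg p U K B, beta_nonneg q U K B, fun h => ?_⟩
  unfold beta at h ⊢
  rcases div_eq_zero_iff.1 h with h0 | h0
  · have hempty : (⋂ j ∈ B, U j) = ∅ := eq_empty_of_ex_ind_eq_zero hp h0
    have : mom q U B = 0 := by unfold mom; rw [hempty]; exact SahiCombDisjunct.ex_ind_empty q
    rw [this, zero_div]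
  · exact absurd h0 (prod_coreP_pos hp K B).ne'

/-- For `X ⊆ [⋃_B K]`: `μ_p([⋃_B K] ∖ X) = P_B − μ_p(X)`. [this work] -/
theorem ex_ind_cyl_diff {p : ι → unitInterval} {K : Fin k → Finset ι} (hdisj : ∀ i j, i ≠ j → Disjoint (K i) (K j))
    (B : Finset (Fin k)) {X : Set (Set ι)} (hX : X ⊆ cyl (B.biUnion K)) :
    ex (bernoulliWeight p) (ind (cyl (B.biUnion K) \ X)) = (∏ j ∈ B, coreP p K j) - ex (bernoulliWeight p) (ind X) := by
  rw [← prod_biUnion_coreP p hdisj, ← ex_ind_cyl, ex_def, ex_def, ex_def, ← sum_sub_distrib]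
  refine sum_congr rfl fun ω _ => ?_
  rw [← mul_sub]
  congr 1
  by_cases hXω : ω ∈ X
  · rw [ind_of_mem hXω, ind_of_mem (hX hXω), ind_of_not_mem (fun h => h.2 hXω)]; ring
  · by_cases hC : ω ∈ cyl (B.biUnion K)
    · rw [ind_of_mem (Set.mem_sdiff_of_mem hC hXω), ind_of_mem hC, ind_of_not_mem hXω]; ring
    · rw [ind_of_not_mem (fun h => hC h.1), ind_of_not_mem hC, ind_of_not_mem hXω]; ring

/-- **The atom `1 − β_B` is rigid**: for interior `p, q` (and events inside their core cylinders), `β_B(p) = 1 ⟹ β_B(q) = 1`: indeed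
`β_B(p) = 1` forces `⋂_{j∈B} U_j = [⋃_{j∈B} K_j]`. [this work] -/
theorem beta_transfer_defect {p q : ι → unitInterval} (hp : ∀ e, (p e : ℝ) ∈ Set.Ioo (0 : ℝ) 1)
    (hq : ∀ e, (q e : ℝ) ∈ Set.Ioo (0 : ℝ) 1) {U : Fin k → Set (Set ι)} {K : Fin k → Finset ι}
    (hdisj : ∀ i j, i ≠ j → Disjoint (K i) (K j)) (hsub : ∀ j, U j ⊆ cyl (K j)) (B : Finset (Fin k)) :
    0 ≤ 1 - beta p U K B ∧ 0 ≤ 1 - beta q U K B ∧ (1 - beta p U K B = 0 → 1 - beta q U K B = 0) := by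
  refine ⟨sub_nonneg.2 (beta_le_one p hdisj hsub B), sub_nonneg.2 (beta_le_one q hdisj hsub B), fun h => ?_⟩
  have h1 : beta p U K B = 1 := by linarith
  have hm : mom p U B = ∏ j ∈ B, coreP p K j := by
    have := mom_eq_prod_mul_beta p hdisj hsub B; rwa [h1, mul_one] at this
  -- the cylinder minus the intersection is `μ_p`-null, hence empty
  have hset : (⋂ j ∈ B, U j) = cyl (B.biUnion K) := by
    refine Set.Subset.antisymm (biInter_subset_cyl hsub B) fun ω hω => ?_
    by_contra hX
    have hdiff : ex (bernoulliWeight p) (ind (cyl (B.biUnion K) \ ⋂ j ∈ B, U j)) = 0 := by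
      rw [ex_ind_cyl_diff hdisj B (biInter_subset_cyl hsub B)]
      change (∏ j ∈ B, coreP p K j) - mom p U B = 0
      rw [hm, sub_self]
    exact absurd hdiff (SharedCoordinate.ex_ind_pos_of_mem hp (Set.mem_sdiff_of_mem hω hX)).ne'
  have hmq : mom q U B = ∏ j ∈ B, coreP q K j := by
    unfold mom; rw [hset, ex_ind_cyl, prod_biUnion_coreP q hdisj]
  have : beta q U K B = 1 := by unfold beta; rw [hmq, div_self (prod_coreP_pos hq K B).ne']
  rw [this, sub_self]

omit [Fintype ι] in
/-- An event inside the cylinder `{a ⊆ ω}` is the trace of its set-section above `a`: `1_X = 1_{X^{a←1}}·1_{[a]}`. [this work] -/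
theorem ind_eq_ind_secUnion_inter_of_subset (a : Set ι) {X : Set (Set ι)} (hX : X ⊆ {ω : Set ι | a ⊆ ω}) :
    ind X = ind (secUnion a X ∩ {ω : Set ι | a ⊆ ω}) := by
  funext ω
  have h := congrFun (SahiCombPrincipalMeet.ind_secUnion_mul_ind_cylinder a X) ω
  simp only [Pi.mul_apply] at h
  rw [← SahiCombPrincipalMeet.ind_mul_apply, h, SahiCombPrincipalMeet.ind_mul_apply, Set.inter_eq_left.2 hX]

/-- **Factorisation above a cylinder**: for `X ⊆ [a]`, `μ_p(X) = μ_p(X^{a←1})·μ_p([a])`. [this work] -/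
theorem ex_ind_eq_secUnion_mul_cyl (p : ι → unitInterval) (a : Set ι) {X : Set (Set ι)} (hX : X ⊆ {ω : Set ι | a ⊆ ω}) :
    ex (bernoulliWeight p) (ind X) =
      ex (bernoulliWeight p) (ind (secUnion a X)) * ex (bernoulliWeight p) (ind {ω : Set ι | a ⊆ ω}) := by
  rw [ind_eq_ind_secUnion_inter_of_subset a hX]
  exact SahiCombPrincipalMeet.ex_ind_cylinder_inter_secUnion p a X

/-- **The Harris gap in closed form.**  With `X = ⋂_A U`, `Y = ⋂_B U`, `a = ⋃_{A∩B} K` and `X', Y'` the set-sections above `[a]`: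
`β_{A∪B} − β_A β_B = (P_{A∩B} / P_{A∪B}) · Cov_p(X', Y')` whenever the core products are non-zero. [this work] -/
theorem beta_gap_eq (p : ι → unitInterval) {U : Fin k → Set (Set ι)} {K : Fin k → Finset ι}
    (hdisj : ∀ i j, i ≠ j → Disjoint (K i) (K j)) (hsub : ∀ j, U j ⊆ cyl (K j)) (A B : Finset (Fin k))
    (hA : ∏ j ∈ A, coreP p K j ≠ 0) (hB : ∏ j ∈ B, coreP p K j ≠ 0) :
    beta p U K (A ∪ B) - beta p U K A * beta p U K B =
      ((∏ j ∈ A ∩ B, coreP p K j) / ∏ j ∈ A ∪ B, coreP p K j) *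
        covFun (secUnion (↑((A ∩ B).biUnion K) : Set ι) (⋂ j ∈ A, U j))
          (secUnion (↑((A ∩ B).biUnion K) : Set ι) (⋂ j ∈ B, U j)) p := by
  set a : Set ι := ↑((A ∩ B).biUnion K) with ha
  -- the three events live inside the cylinder `[a]`
  have hXa : (⋂ j ∈ A, U j) ⊆ {ω : Set ι | a ⊆ ω} := fun ω hω =>
    (biInter_subset_cyl hsub (A ∩ B)) (Set.biInter_subset_biInter_left (coe_subset.2 inter_subset_left) hω)
  have hYa : (⋂ j ∈ B, U j) ⊆ {ω : Set ι | a ⊆ ω} := fun ω hω =>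
    (biInter_subset_cyl hsub (A ∩ B)) (Set.biInter_subset_biInter_left (coe_subset.2 inter_subset_right) hω)
  have hXYa : (⋂ j ∈ A ∪ B, U j) ⊆ {ω : Set ι | a ⊆ ω} := fun ω hω => by
    rw [biInter_union] at hω; exact hXa hω.1
  have hcyl : ex (bernoulliWeight p) (ind {ω : Set ι | a ⊆ ω}) = ∏ j ∈ A ∩ B, coreP p K j := by
    rw [← prod_biUnion_coreP p hdisj]; exact ex_ind_cyl p _
  have hPP : (∏ j ∈ A, coreP p K j) * ∏ j ∈ B, coreP p K j =
      (∏ j ∈ A ∪ B, coreP p K j) * ∏ j ∈ A ∩ B, coreP p K j := (prod_union_inter).symm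
  have hU0 : ∏ j ∈ A ∪ B, coreP p K j ≠ 0 := fun h0 => by
    rw [h0, zero_mul] at hPP; exact mul_ne_zero hA hB hPP
  have hI0 : ∏ j ∈ A ∩ B, coreP p K j ≠ 0 := fun h0 => by
    rw [h0, mul_zero] at hPP; exact mul_ne_zero hA hB hPP
  have mA : mom p U A = ex (bernoulliWeight p) (ind (secUnion a (⋂ j ∈ A, U j))) * ∏ j ∈ A ∩ B, coreP p K j := by
    unfold mom; rw [ex_ind_eq_secUnion_mul_cyl p a hXa, hcyl]
  have mB : mom p U B = ex (bernoulliWeight p) (ind (secUnion a (⋂ j ∈ B, U j))) * ∏ j ∈ A ∩ B, coreP p K j := by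
    unfold mom; rw [ex_ind_eq_secUnion_mul_cyl p a hYa, hcyl]
  have mAB : mom p U (A ∪ B) =
      ex (bernoulliWeight p) (ind (secUnion a (⋂ j ∈ A, U j) ∩ secUnion a (⋂ j ∈ B, U j))) * ∏ j ∈ A ∩ B, coreP p K j := by
    unfold mom; rw [ex_ind_eq_secUnion_mul_cyl p a hXYa, hcyl, biInter_union, secUnion_inter]
  unfold beta covFun
  rw [mA, mB, mAB, div_mul_div_comm, hPP]
  field_simp

/-- **The Harris-gap atom `β_{A∪B} − β_Aβ_B` is rigid**: for interior `p, q` it is `≥ 0` at both, and if it vanishes at `p` it vanishes at `q`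
(equality in Harris for the set-sections at the interior point `p` forces disjoint determining sets, hence equality at every `q`). [this work] -/
theorem beta_transfer_gap {p q : ι → unitInterval} (hp : ∀ e, (p e : ℝ) ∈ Set.Ioo (0 : ℝ) 1)
    (hq : ∀ e, (q e : ℝ) ∈ Set.Ioo (0 : ℝ) 1) {U : Fin k → Set (Set ι)} (hU : ∀ j, IsUpperSet (U j)) {K : Fin k → Finset ι}
    (hdisj : ∀ i j, i ≠ j → Disjoint (K i) (K j)) (hsub : ∀ j, U j ⊆ cyl (K j)) (S A B : Finset (Fin k)) (hS : A ∪ B = S) :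
    0 ≤ beta p U K S - beta p U K A * beta p U K B ∧ 0 ≤ beta q U K S - beta q U K A * beta q U K B ∧
      (beta p U K S - beta p U K A * beta p U K B = 0 → beta q U K S - beta q U K A * beta q U K B = 0) := by
  subst hS
  refine ⟨sub_nonneg.2 (beta_supermul p hU hdisj hsub A B), sub_nonneg.2 (beta_supermul q hU hdisj hsub A B), fun h => ?_⟩
  set a : Set ι := ↑((A ∩ B).biUnion K) with ha
  set X' : Set (Set ι) := secUnion a (⋂ j ∈ A, U j) with hX'
  set Y' : Set (Set ι) := secUnion a (⋂ j ∈ B, U j) with hY'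
  have hX'up : IsUpperSet X' := isUpperSet_secUnion a (isUpperSet_biInter A hU)
  have hY'up : IsUpperSet Y' := isUpperSet_secUnion a (isUpperSet_biInter B hU)
  -- at `p`: the gap vanishes, so `Cov_p(X', Y') = 0`
  rw [beta_gap_eq p hdisj hsub A B (prod_coreP_pos hp K A).ne' (prod_coreP_pos hp K B).ne'] at h
  have hcoef : (∏ j ∈ A ∩ B, coreP p K j) / ∏ j ∈ A ∪ B, coreP p K j ≠ 0 :=
    div_ne_zero (prod_coreP_pos hp K _).ne' (prod_coreP_pos hp K _).ne'
  have hcov : covFun X' Y' p = 0 := (mul_eq_zero.1 h).resolve_left hcoef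
  -- equality case of Harris at the interior point `p`: disjoint determining sets
  have hprod : ex (bernoulliWeight p) (ind X' * ind Y') = ex (bernoulliWeight p) (ind X') * ex (bernoulliWeight p) (ind Y') := by
    have e : ind X' * ind Y' = ind (X' ∩ Y') := funext fun ω => SahiCombPrincipalMeet.ind_mul_apply X' Y' ω
    rw [e]; unfold covFun at hcov; linarith
  obtain ⟨F, F', hFF', hF, hF'⟩ := disjoint_determinedBy_of_real_inter_eq p hp hX'up hY'up hprod
  -- hence independence at every `q`
  have hcovq : covFun X' Y' q = 0 := by
    unfold covFun
    rw [ex_bernoulliWeight_ind, ex_bernoulliWeight_ind, ex_bernoulliWeight_ind,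
      prodBernoulli_real_inter_of_determinedBy_disjoint q hFF' hF hF' MeasurableSet.of_discrete MeasurableSet.of_discrete,
      sub_self]
  rw [beta_gap_eq q hdisj hsub A B (prod_coreP_pos hq K A).ne' (prod_coreP_pos hq K B).ne', hcovq, mul_zero]

end Atoms

/-! ### 3. The reduction: a transferable certificate gives pointwise (EQ) on the principal-cap stratum -/

section Reduction

variable {ι : Type} [Fintype ι] {k : ℕ}

/-- **Pointwise (EQ-(k+1)) on the principal-cap stratum from a transferable `F(k+1)`-certificate.**  Suppose that `Φ_{k+1}(β) = 0` implies
`Φ_{k+1}(β') = 0` whenever `β_⊤ = β'_⊤ = 1` and the three kinds of atoms transfer from `β` to `β'` (hypothesis `PT`; at orders `≤ 6` this is read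
off P4's product certificates).  Then for every family of `k+1` increasing events whose common part is a principal up-set and every interior `p`:
`E_{k+1}(μ_p; 1_U) = 0 ↔ U ∈ Z_{k+1}`. [this work] -/
theorem sahiE_ind_eq_zero_iff_of_principalCap_of_phiTransfer
    (PT : ∀ β β' : Finset (Fin (k + 1)) → ℝ, β univ = 1 → β' univ = 1 →
        (∀ B, 0 ≤ β B ∧ 0 ≤ β' B ∧ (β B = 0 → β' B = 0)) →
        (∀ B, 0 ≤ 1 - β B ∧ 0 ≤ 1 - β' B ∧ (1 - β B = 0 → 1 - β' B = 0)) →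
        (∀ S A B : Finset (Fin (k + 1)), A ∪ B = S →
          0 ≤ β S - β A * β B ∧ 0 ≤ β' S - β' A * β' B ∧ (β S - β A * β B = 0 → β' S - β' A * β' B = 0)) →
        phiSet (k + 1) β = 0 → phiSet (k + 1) β' = 0)
    {p : ι → unitInterval} (hp : ∀ e, (p e : ℝ) ∈ Set.Ioo (0 : ℝ) 1) (U : Fin (k + 1) → Set (Set ι))
    (hU : ∀ j, IsUpperSet (U j)) (c : Finset ι) (hpc : ∀ T : Set ι, (∀ j, T ∈ U j) ↔ (↑c : Set ι) ⊆ T) :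
    sahiE (bernoulliWeight p) (k + 1) (fun j => ind (U j)) = 0 ↔ SuppZeroFlag (k + 1) U := by
  refine ⟨fun hz => ?_, fun hZ => masterFamilyEqIff_mpr _ ι p U hZ⟩
  obtain ⟨K, hdisj, hsub, hcap⟩ := cores_of_principalCap hU c hpc
  have hΦp : phiSet (k + 1) (beta p U K) = 0 := by
    rw [sahiE_ind_eq_mul_phiSet p U K hdisj hsub] at hz
    exact (mul_eq_zero.1 hz).resolve_left (prod_coreP_pos hp K univ).ne'
  refine suppZeroFlag_of_eq_zero_on_paramBox U hU (a := fun _ => 0) (b := fun _ => 1) (fun _ => zero_lt_one)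
    (fun _ => le_rfl) (fun _ => le_rfl) fun q hq => ?_
  have hq' : ∀ e, (q e : ℝ) ∈ Set.Ioo (0 : ℝ) 1 := fun e => hq e
  rw [sahiE_ind_eq_mul_phiSet q U K hdisj hsub,
    PT (beta p U K) (beta q U K) (beta_univ p hdisj hsub hcap (prod_coreP_pos hp K univ).ne')
      (beta_univ q hdisj hsub hcap (prod_coreP_pos hq' K univ).ne') (fun B => beta_transfer_base q hp U K B)
      (fun B => beta_transfer_defect hp hq' hdisj hsub B) (fun S A B hS => beta_transfer_gap hp hq' hU hdisj hsub S A B hS) hΦp,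
    mul_zero]

/-- The strict form: off `Z_{k+1}`, `E_{k+1}(μ_p; 1_U) ≠ 0` at every interior `p` (its sign is the business of `F(k+1)`). [this work] -/
theorem sahiE_ind_ne_zero_of_principalCap_of_phiTransfer
    (PT : ∀ β β' : Finset (Fin (k + 1)) → ℝ, β univ = 1 → β' univ = 1 →
        (∀ B, 0 ≤ β B ∧ 0 ≤ β' B ∧ (β B = 0 → β' B = 0)) →
        (∀ B, 0 ≤ 1 - β B ∧ 0 ≤ 1 - β' B ∧ (1 - β B = 0 → 1 - β' B = 0)) →
        (∀ S A B : Finset (Fin (k + 1)), A ∪ B = S →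
          0 ≤ β S - β A * β B ∧ 0 ≤ β' S - β' A * β' B ∧ (β S - β A * β B = 0 → β' S - β' A * β' B = 0)) →
        phiSet (k + 1) β = 0 → phiSet (k + 1) β' = 0)
    {p : ι → unitInterval} (hp : ∀ e, (p e : ℝ) ∈ Set.Ioo (0 : ℝ) 1) (U : Fin (k + 1) → Set (Set ι))
    (hU : ∀ j, IsUpperSet (U j)) (c : Finset ι) (hpc : ∀ T : Set ι, (∀ j, T ∈ U j) ↔ (↑c : Set ι) ⊆ T)
    (hZ : ¬ SuppZeroFlag (k + 1) U) : sahiE (bernoulliWeight p) (k + 1) (fun j => ind (U j)) ≠ 0 :=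
  fun h => hZ ((sahiE_ind_eq_zero_iff_of_principalCap_of_phiTransfer PT hp U hU c hpc).1 h)

end Reduction

end Pointwise

end Summit.CriticalPhenomena.PercolationContinuityZ3.Theorems
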